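import Literature.AlgebraicGeometry.Resolution.RidgeEqualDegree
import Literature.AlgebraicGeometry.Resolution.HironakaDirectrixIdeal
import Literature.AlgebraicGeometry.Resolution.HironakaDirectrixPolarTame
import HarnessLib

/-!
# `Rid = Dir` as subschemes for cones defined in one tame degree: the ridge ideal is the directrix ideal, and the
# directrix space is spanned by the linear Hasse–Schmidt coefficients (Schober 2021 Rem. 2.6; BHM 2010 Rem. 2.8 /
# Rem. 3.12; CJS 2020 Lemma 2.7 / Def. 2.8)

Topic: `Literature/AlgebraicGeometry/Resolution`. Sequel of `RidgeEqualDegree.lean` (for a set `G` of forms of ONE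
degree `b` with `1, …, b` non-zero in `K`, the ridge ideal `𝔉(⟨G⟩)` is generated by the linear Hasse–Schmidt
coefficients `linearHasseSet G b`), `HironakaDirectrixPolarTame.lean` (tame: Hironaka's invariance space `𝕎(S)` is
the joint polar kernel), `HironakaDirectrixIdeal.lean` (the bridge `𝒯(I) ⊆ T(S)` between the CJS directrix space of
an ideal and Hironaka's directrix `T(S) = 𝕎(S)^⊥` of a set) and `Ridge.lean` (`𝔉 ⊆ 𝒯(I)·S`, i.e. `Dir ⊆ Rid`).

> **Schober 2021, Rem. 2.6.** "In the case `char(K) = 0` … we have `Dir(C) = Rid(C)`." **BHM 2010, Rem. 2.8 / 3.12.**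
> "the ridge … coincides with the directrix if all the additive polynomials are of degree one."
> **CJS 2020, Lemma 2.7 / Def. 2.8.** `𝒯(I)` the smallest `T ⊆ S_1` with `I = (I ∩ k[T])S`; `Dir = Spec S/𝒯(I)S`.

PROVED here, for `G` a set of forms of degree `b` over a field `K` with `1, …, b` non-zero in `K` (characteristic `0`,
or `p > b`; the tangent cone of an ideal exponent of order `b` in that regime):
* `mem_ridge_span_iff_mem_invarianceSpace` — on `K`-points, `Rid(⟨G⟩)(K) = 𝕎(G)` (Giraud's ridge = Hironaka's
  invariance space);
* `map_directrix_eq_span_linearHasseSet` — **Hironaka's directrix `T(G)` is the span of the linear Hasse–Schmidt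
  coefficients** `D_A g`, `g ∈ G`, `|A| + 1 = b` (double annihilator), so `τ(G) = dim span(linearHasseSet G b)`;
* `directrixSpace_span_eq_span_linearHasseSet`, `directrixSpace_span_eq_map_directrix` — **the CJS directrix space of
  the ideal `⟨G⟩` is the same span: `𝒯(⟨G⟩) = T(G)`**;
* **`ridgeIdeal_span_eq_span_directrixSpace` — `𝔉(⟨G⟩) = 𝒯(⟨G⟩) · S`: the ridge and the directrix of the cone
  `V(G)` coincide AS SUBSCHEMES of the tangent space** (not only on `K`-points), with `…_of_lt_char` (`[CharP K p]`,
  `b < p`) and `…_of_charZero`.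

Written for the cell res-hironaka (seat res-L1-s46-pv-7, W4.6 rung (iv)): in regime (iv) (`p > b`) the three
tangent-cone invariants of the typed procedure — directrix, `τ`, ridge — collapse to one linear datum, as in
characteristic zero. AI-written; AI review is weaker than expert review.

## References

* B. Schober, J. Algebra 565 (2021), Rem. 2.6. [Schober2021IdealisticExponents]
* J. Berthomieu, P. Hivert, H. Mourtada, Contemp. Math. 521 (2010), Rem. 2.8, Rem. 3.12, Lemma 3.6.
  [BerthomieuHivertMourtada2010]
* V. Cossart, U. Jannsen, S. Saito, LNM 2270 (2020), Lemma 2.7, Def. 2.8. [CossartJannsenSaito2020]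
* V. Cossart, O. Piltant, J. Algebra 320 (2008), proof of Prop. 4.2. [CossartPiltant2008]
-/

noncomputable section

open MvPolynomial Module
open Literature.RingTheory.MvPolynomial

namespace Literature.AlgebraicGeometry.Resolution

universe u

variable {K : Type u} [Field K] {n : ℕ}

/-! ## Linear forms: evaluation, and the degree-one part of a linear ideal -/

section Linear

/-- Evaluating the linear form of a functional: `(Σ_i ℓ(e_i) Y_i)(v) = ℓ(v)`. [folklore] -/
private theorem aeval_linearFormPoly_eq (ℓ : Module.Dual K (Fin n → K)) (v : Fin n → K) :
    aeval v (linearFormPoly K ℓ) = ℓ v := by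
  rw [linearFormPoly, map_sum, dual_apply_eq_sum]
  refine Finset.sum_congr rfl fun i _ => ?_
  rw [map_mul, aeval_C, aeval_X, Algebra.algebraMap_self, RingHom.id_apply, mul_comm]

/-- The degree-`b` component of a multiple of a form of degree `b`: `(q · h)_b = q(0) · h`. [folklore] -/
private theorem homogeneousComponent_mul_of_isHomogeneous_self' {h : MvPolynomial (Fin n) K} {b : ℕ}
    (hh : h.IsHomogeneous b) (q : MvPolynomial (Fin n) K) : homogeneousComponent b (q * h) = C (coeff 0 q) * h := by
  classical
  have hq : q * h = ∑ i ∈ Finset.range (q.totalDegree + 1), homogeneousComponent i q * h := by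
    rw [← Finset.sum_mul, sum_homogeneousComponent]
  rw [hq, map_sum, Finset.sum_eq_single 0]
  · rw [homogeneousComponent_zero, homogeneousComponent_of_mem
      ((mem_homogeneousSubmodule _ _).mpr ((isHomogeneous_C _ (coeff 0 q)).mul hh)), if_pos (zero_add b).symm]
  · intro i _ hi0
    rw [homogeneousComponent_of_mem
      ((mem_homogeneousSubmodule _ _).mpr ((homogeneousComponent_isHomogeneous i q).mul hh)), if_neg (by omega)]
  · intro h0
    exact absurd (Finset.mem_range.mpr (Nat.succ_pos _)) h0

/-- **A linear form in the ideal generated by a space `T` of linear forms lies in `T`** (compare degree-one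
components: `l = Σ a_t t` gives `l = Σ a_t(0) t`). [cite: CossartJannsenSaito2020, Lemma 2.7] -/
theorem mem_of_isHomogeneous_one_of_mem_ideal_span {T : Submodule K (MvPolynomial (Fin n) K)}
    (hT : T ≤ homogeneousSubmodule (Fin n) K 1) {l : MvPolynomial (Fin n) K} (hl : l.IsHomogeneous 1)
    (hmem : l ∈ Ideal.span (T : Set (MvPolynomial (Fin n) K))) : l ∈ T := by
  classical
  obtain ⟨c, hcT, hsum⟩ := (Submodule.mem_span_set (R := MvPolynomial (Fin n) K)).mp hmem
  have hl1 : l = ∑ t ∈ c.support, C (coeff 0 (c t)) * t := by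
    conv_lhs => rw [← (homogeneousComponent_of_mem ((mem_homogeneousSubmodule _ _).mpr hl)).trans (if_pos rfl),
      ← hsum]
    rw [Finsupp.sum, map_sum]
    refine Finset.sum_congr rfl fun t ht => ?_
    rw [smul_eq_mul]
    exact homogeneousComponent_mul_of_isHomogeneous_self' ((mem_homogeneousSubmodule _ _).mp (hT (hcT ht))) _
  rw [hl1]
  refine Submodule.sum_mem _ fun t ht => ?_
  rw [← smul_eq_C_mul]
  exact T.smul_mem _ (hcT ht)

/-- The ideal generated by a set equals the ideal generated by its `K`-span. [folklore] -/
private theorem ideal_span_eq_ideal_span_span (L : Set (MvPolynomial (Fin n) K)) :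
    Ideal.span L = Ideal.span (Submodule.span K L : Set (MvPolynomial (Fin n) K)) := by
  refine le_antisymm (Ideal.span_mono Submodule.subset_span) (Ideal.span_le.mpr fun l hl => ?_)
  have hle : Submodule.span K L ≤ (Ideal.span L).restrictScalars K :=
    Submodule.span_le.mpr fun x hx => Ideal.subset_span hx
  exact hle hl

end Linear

/-! ## Tame cones defined in one degree: `Rid = Dir` -/

section Tame

variable {G : Set (MvPolynomial (Fin n) K)} {b : ℕ}

/-- The linear Hasse–Schmidt coefficients span a space of linear forms. [cite: BerthomieuHivertMourtada2010, Algorithm 3.5] -/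
theorem span_linearHasseSet_le_one (hG : ∀ g ∈ G, g.IsHomogeneous b) :
    Submodule.span K (linearHasseSet G b) ≤ homogeneousSubmodule (Fin n) K 1 :=
  Submodule.span_le.mpr fun _ hl => (mem_homogeneousSubmodule _ _).mpr (isHomogeneous_one_of_mem_linearHasseSet hG hl)

/-- **`Rid(⟨G⟩)(K) = 𝕎(G)`: on `K`-points Giraud's ridge of a cone defined in one tame degree is Hironaka's
invariance space of its generators** (both are the joint kernel of the polar maps `w ↦ Σ_i w_i ∂_i g`).
[cite: Schober2021IdealisticExponents, Rem. 2.6] [cite: CossartPiltant2008, proof of Prop. 4.2] -/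
theorem mem_ridge_span_iff_mem_invarianceSpace (hG : ∀ g ∈ G, g.IsHomogeneous b)
    (hchar : ∀ m : ℕ, 1 ≤ m → m ≤ b → (m : K) ≠ 0) (v : Fin n → K) :
    v ∈ ridge K (Ideal.span G) ↔ v ∈ invarianceSpace K G := by
  have hchar' : ∀ F ∈ G, ∀ m : ℕ, 1 ≤ m → m ≤ F.totalDegree → (m : K) ≠ 0 :=
    fun F hF m h1 hm => hchar m h1 (hm.trans (hG F hF).totalDegree_le)
  rw [ridge_span_eq_iInf hG, AddSubmonoid.mem_iInf, invarianceSpace_eq_iInf_ker_polar K G hchar',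
    Submodule.mem_iInf]
  refine forall_congr' fun g => ?_
  rw [AddSubmonoid.mem_iInf, Submodule.mem_iInf]
  refine forall_congr' fun hg => ?_
  rw [ridge_span_singleton_iff_polar_eq_zero (hG g hg) hchar v, Algebra.algebraMap_self, MvPolynomial.map_id,
    LinearMap.mem_ker, Fintype.linearCombination_apply]
  simp only [MvPolynomial.smul_eq_C_mul]

/-- The `K`-points of the ridge are the common zeros of the linear Hasse–Schmidt coefficients, i.e. the dual
coannihilator of the corresponding space of functionals. [cite: BerthomieuHivertMourtada2010, Lemma 3.6] -/
theorem invarianceSpace_eq_dualCoannihilator (hG : ∀ g ∈ G, g.IsHomogeneous b)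
    (hchar : ∀ m : ℕ, 1 ≤ m → m ≤ b → (m : K) ≠ 0) :
    invarianceSpace K G = ((Submodule.span K (linearHasseSet G b)).comap (linearFormPolyₗ K)).dualCoannihilator := by
  ext v
  rw [← mem_ridge_span_iff_mem_invarianceSpace hG hchar, mem_ridge_span_iff_forall_linearHasseSet hG hchar,
    Submodule.mem_dualCoannihilator]
  constructor
  · intro h ℓ hℓ
    rw [Submodule.mem_comap, linearFormPolyₗ_apply] at hℓ
    rw [← aeval_linearFormPoly_eq]
    -- `aeval v` vanishes on the `K`-span of the linear Hasse coefficients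
    have hle : Submodule.span K (linearHasseSet G b) ≤ LinearMap.ker ((aeval v).toLinearMap.restrictScalars K) :=
      Submodule.span_le.mpr fun l hl => h l hl
    exact hle hℓ
  · intro h l hl
    have hl1 : l ∈ LinearMap.range (linearFormPolyₗ K (d := n)) := by
      rw [range_linearFormPolyₗ]
      exact (mem_homogeneousSubmodule _ _).mpr (isHomogeneous_one_of_mem_linearHasseSet hG hl)
    obtain ⟨ℓ, rfl⟩ := hl1
    rw [linearFormPolyₗ_apply, aeval_linearFormPoly_eq]
    exact h ℓ (by rw [Submodule.mem_comap, linearFormPolyₗ_apply]; exact Submodule.subset_span hl)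

/-- **Hironaka's directrix of a tame set of forms of one degree is spanned by the linear Hasse–Schmidt coefficients**
(as functionals): `T(G) = 𝕎(G)^⊥ = span(linearHasseSet G b)` by the double annihilator.
[cite: CossartPiltant2008, proof of Prop. 4.2] [cite: BerthomieuHivertMourtada2010, Algorithm 3.5] -/
theorem directrix_eq_comap_span_linearHasseSet (hG : ∀ g ∈ G, g.IsHomogeneous b)
    (hchar : ∀ m : ℕ, 1 ≤ m → m ≤ b → (m : K) ≠ 0) :
    directrix K G = (Submodule.span K (linearHasseSet G b)).comap (linearFormPolyₗ K) := by
  rw [directrix, invarianceSpace_eq_dualCoannihilator hG hchar, Subspace.dualCoannihilator_dualAnnihilator_eq]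

/-- **`T(G) = span(D_A g : g ∈ G, |A| + 1 = b)` as linear forms.** [cite: BerthomieuHivertMourtada2010, Algorithm 3.5] -/
theorem map_directrix_eq_span_linearHasseSet (hG : ∀ g ∈ G, g.IsHomogeneous b)
    (hchar : ∀ m : ℕ, 1 ≤ m → m ≤ b → (m : K) ≠ 0) :
    (directrix K G).map (linearFormPolyₗ K) = Submodule.span K (linearHasseSet G b) := by
  rw [directrix_eq_comap_span_linearHasseSet hG hchar, map_comap_linearFormPolyₗ K (span_linearHasseSet_le_one hG)]

/-- **`τ(G) = dim_K span(linearHasseSet G b)`** in tame degree. [cite: CossartPiltant2008, proof of Prop. 4.2] -/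
theorem hironakaTau_eq_finrank_span_linearHasseSet (hG : ∀ g ∈ G, g.IsHomogeneous b)
    (hchar : ∀ m : ℕ, 1 ≤ m → m ≤ b → (m : K) ≠ 0) :
    hironakaTau K G = Module.finrank K (Submodule.span K (linearHasseSet G b)) := by
  rw [← finrank_map_directrix (k := K) G, map_directrix_eq_span_linearHasseSet hG hchar]

/-- **The CJS directrix space of the ideal `⟨G⟩` is the span of the linear Hasse–Schmidt coefficients**:
`𝒯(⟨G⟩) ⊆ T(G) = span L` (bridge) and `L ⊆ 𝔉 ⊆ 𝒯(⟨G⟩)·S` with `L` linear.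
[cite: CossartJannsenSaito2020, Lemma 2.7] [cite: BerthomieuHivertMourtada2010, Algorithm 3.5] -/
theorem directrixSpace_span_eq_span_linearHasseSet (hG : ∀ g ∈ G, g.IsHomogeneous b)
    (hchar : ∀ m : ℕ, 1 ≤ m → m ≤ b → (m : K) ≠ 0) :
    directrixSpace (Ideal.span G) = Submodule.span K (linearHasseSet G b) := by
  apply le_antisymm
  · rw [← map_directrix_eq_span_linearHasseSet hG hchar]
    exact directrixSpace_le_map_directrix rfl
  · refine Submodule.span_le.mpr fun l hl => ?_
    have hl𝔉 : l ∈ ridgeIdeal (Ideal.span G) := by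
      rw [ridgeIdeal_span_eq_span_linearHasseSet hG hchar]
      exact Ideal.subset_span hl
    exact mem_of_isHomogeneous_one_of_mem_ideal_span (directrixSpace_le_one _)
      (isHomogeneous_one_of_mem_linearHasseSet hG hl) (ridgeIdeal_le_span_directrixSpace _ hl𝔉)

/-- **`𝒯(⟨G⟩) = T(G)`**: for a tame set of forms of one degree the CJS directrix space of the ideal and Hironaka's
directrix of the set coincide. [cite: CossartJannsenSaito2020, Lemma 2.7] [cite: CossartPiltant2008, proof of Prop. 4.2] -/
theorem directrixSpace_span_eq_map_directrix (hG : ∀ g ∈ G, g.IsHomogeneous b)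
    (hchar : ∀ m : ℕ, 1 ≤ m → m ≤ b → (m : K) ≠ 0) :
    directrixSpace (Ideal.span G) = (directrix K G).map (linearFormPolyₗ K) := by
  rw [directrixSpace_span_eq_span_linearHasseSet hG hchar, map_directrix_eq_span_linearHasseSet hG hchar]

/-- **`dim_K 𝒯(⟨G⟩) = τ(G)`** in tame degree. [cite: CossartJannsenSaito2020, Def. 2.8] -/
theorem finrank_directrixSpace_span_eq_hironakaTau (hG : ∀ g ∈ G, g.IsHomogeneous b)
    (hchar : ∀ m : ℕ, 1 ≤ m → m ≤ b → (m : K) ≠ 0) :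
    Module.finrank K (directrixSpace (Ideal.span G)) = hironakaTau K G := by
  rw [directrixSpace_span_eq_map_directrix hG hchar, finrank_map_directrix]

/-- **`Rid = Dir` AS SUBSCHEMES for a cone defined in one tame degree: `𝔉(⟨G⟩) = 𝒯(⟨G⟩) · S`** — the ideal of
Giraud's ridge is the ideal of the CJS directrix (both generated by the span of the linear Hasse–Schmidt coefficients).
[cite: Schober2021IdealisticExponents, Rem. 2.6] [cite: BerthomieuHivertMourtada2010, Rem. 3.12] -/
theorem ridgeIdeal_span_eq_span_directrixSpace (hG : ∀ g ∈ G, g.IsHomogeneous b)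
    (hchar : ∀ m : ℕ, 1 ≤ m → m ≤ b → (m : K) ≠ 0) :
    ridgeIdeal (Ideal.span G) = Ideal.span (directrixSpace (Ideal.span G) : Set (MvPolynomial (Fin n) K)) := by
  rw [ridgeIdeal_span_eq_span_linearHasseSet hG hchar, directrixSpace_span_eq_span_linearHasseSet hG hchar]
  exact ideal_span_eq_ideal_span_span _

/-- **Characteristic `p > b`**: `Rid = Dir` as subschemes for a cone defined by forms of degree `b < p`.
[cite: Schober2021IdealisticExponents, Rem. 2.6] -/
theorem ridgeIdeal_span_eq_span_directrixSpace_of_lt_char (p : ℕ) [CharP K p] (hG : ∀ g ∈ G, g.IsHomogeneous b)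
    (hbp : b < p) :
    ridgeIdeal (Ideal.span G) = Ideal.span (directrixSpace (Ideal.span G) : Set (MvPolynomial (Fin n) K)) := by
  refine ridgeIdeal_span_eq_span_directrixSpace hG fun m h1 hm => ?_
  rw [Ne, CharP.cast_eq_zero_iff K p m]
  exact fun hdvd => absurd (Nat.le_of_dvd (by omega) hdvd) (by omega)

/-- **Characteristic `0`**: `Rid = Dir` as subschemes for every cone defined by forms of one degree.
[cite: Schober2021IdealisticExponents, Rem. 2.6] -/
theorem ridgeIdeal_span_eq_span_directrixSpace_of_charZero [CharZero K] (hG : ∀ g ∈ G, g.IsHomogeneous b) :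
    ridgeIdeal (Ideal.span G) = Ideal.span (directrixSpace (Ideal.span G) : Set (MvPolynomial (Fin n) K)) :=
  ridgeIdeal_span_eq_span_directrixSpace hG fun m h1 _ => by exact_mod_cast (by omega : m ≠ 0)

/-- **`e(S/⟨G⟩) ≤ dim Rid ≤ …` collapses: in tame degree the directrix dimension bounds become the statement that
`Dir` and `Rid` have the same ideal**; recorded numerically as `dim_K 𝒯(⟨G⟩) = τ(G) = dim span(linearHasseSet)`.
[cite: CossartJannsenSaito2020, Remark 18.29] -/
theorem directrixDim_span_eq (hG : ∀ g ∈ G, g.IsHomogeneous b) (hchar : ∀ m : ℕ, 1 ≤ m → m ≤ b → (m : K) ≠ 0) :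
    directrixDim (Ideal.span G) = n - Module.finrank K (Submodule.span K (linearHasseSet G b)) := by
  rw [directrixDim, directrixSpace_span_eq_span_linearHasseSet hG hchar]

end Tame

end Literature.AlgebraicGeometry.Resolution

end
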